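import Literature.MathematicalPhysics.QuantumFieldTheory.Balaban1983to89.B8Eq1123ConcreteRec
import Literature.MathematicalPhysics.QuantumFieldTheory.Balaban1983to89.B8Eq106LocalRec
import Literature.MathematicalPhysics.QuantumFieldTheory.Balaban1983to89.B8Eq1117KLevel

/-!
# `Balaban1983to89.B8Eq1117KLevelRec` — RECORD TWIN of `B8Eq1117KLevel` §4–§5 ([Balaban1985RegularSpaces] Sect. E pp. 95–97: (1.114)–(1.116) on `𝔅_k` «the solution
# linearises `Q′(u₁, ·)`», and «`u₁` is given by (106)» on the towers for THE inductive `u₁`) for the SYMMETRISED CENTRED block averaging (0.4) of [Balaban1987RG1]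

statement-level skeleton of published theorems with citation tags; proofs where landed; nothing here is a claim about the Yang–Mills mass gap

T. Bałaban, *Spaces of regular gauge field configurations on a lattice and gauge fixing conditions*, Commun. Math. Phys. **99** (1985) 75–102
`[Balaban1985RegularSpaces]` ("[6]"): (1.113)–(1.117) pp. 95–96, (1.91) p. 91, p. 88 (sentence after (1.69)), (1.19) p. 79, (1.29) p. 81; T. Bałaban, *Averaging operations for
lattice gauge theories*, Commun. Math. Phys. **98** (1985) 17–51 `[Balaban1985Averaging]` ("[3]"): (106) p. 33, (213) p. 50; T. Bałaban, *Renormalization group approach to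
lattice gauge field theories. I*, Commun. Math. Phys. **109** (1987) 249–301 `[Balaban1987RG1]` ("[I]"): (0.3)–(0.4) pp. 252–253, pp. 253–254.  STATUS: published, refereed.

CITATION HEADER (lean-in-tree rule).  Cell `pub-ymgap`, base `pub-ymgap-dag-n05-c` g26 — N05-REC stage 2 (director-ym №254∕№255∕№265∕№267), item R5, LEAD PEN dag-n05-e
(inventory `N05-REC-INVENTORY.md` e50db04501ab292d §R5 row `B8Eq1117KLevel`: A `glev_on_towers_of_axial eq1114_of_fixedPoint_kLevel`).  WHAT IS REPRODUCED = the two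
on-path theorems of ✓`B8Eq1117KLevel` under the cell's TOKEN RULE: §4 `eq1114_of_fixedPoint_kLevel` with `Qnl ∕ Cnl ↦ QnlZ ∕ CnlZ` and `QprimeIter (zdBlocking d L) (bgT L U₀) ↦
QprimeIter (zdBlockingZ d L) (bgTZ L U₀)` (pure algebra (1.113)–(1.116)); §5 `glevZ_on_towers_of_axial` with `InAx ∕ Restr129 ∕ glev ∕ Under ↦ InAxZ ∕ Restr129Z ∕ glevZ ∕
UnderZ` over dag-n05-d's `B8Eq106LocalRec.eq106_of_inAxZ_restr129Z` (centred towers, odd `L = 2s+1`).  The engine's §1–§3 (`dom120_of_119_tower`, (1.121) ∕ Lipschitz on a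
tower, «exactly one solution of (1.117)», `norm_Dprime_le_kLevel`, `exists_Dprime_kLevel(_of_axial)`) rest on [3] Prop. 10 ∕ (214) ∕ (1.122) twins (road item R1) and are NOT
twinned here (APPEND-ONLY v1.1); `XSpace`, `QprimeIter_line` are structure-free, REUSED BY NAME.  Kind «kernel-checked proof», theorems only; no `def`, no `instance`, no
`notation`, no existing module modified.  `--supports stmt-QuantumFields-20541` (K0⁷-keyed, COUNT-NEUTRAL).

HONEST SCOPE: algebra + a composition of landed twins; NO inequality of [3]∕[6]∕[I]; `HThm4Rec` UNDISCHARGED; caveat (C-S3-1) + addendum v4 («hybrid record — (128)∕(130)∕(131)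
hold for the record k-uniformly with constants ×(1+4dL); the carried coarse gauge letter Λ_j is absorbed into the data B₁ of (1.56) by the Stokes estimate; flat-letter layer
off the path modulo N2a–c»); N05 [B8] DISCHARGED OF RECORD untouched; COUNT of record unmoved · K numerically unchanged; one finite `𝕋⁴` programme at fixed `ε`, Bałaban AS
PRINTED; nothing continuum ∕ ℝ⁴ ∕ OS ∕ mass-gap ∕ Clay.  No `sorry`, no `def`.

[cite: Balaban1985RegularSpaces, (1.113)–(1.117) pp.95–96, (1.91) p.91, p.88, (1.19) p.79, (1.29) p.81; Balaban1985Averaging, (106) p.33, (213) p.50; Balaban1987RG1, (0.3)–(0.4) pp.252–253]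
-/

noncomputable section

open NormedSpace Finset

namespace Literature.MathematicalPhysics.QuantumFieldTheory.Balaban1983to89.B8Eq1117KLevelRec

open B7Prop1Explicit B7Prop2Explicit B7Prop3Flat B7Prop1Local
open B7Eq78Linearization (QprimeIter)
open B7Eq92Concrete (mgauge)
open B8Eq1123Concrete (QprimeIter_line)
open B8Eq1117Concrete (XSpace)
open BlockAveragingZd (offZ avgIterZ)
open B7SectCDGaugeAveragesRec (glevZ)
open B7SectEFLinearisationRec (zdBlockingZ bgTZ)
open B8Ineq130Rec (tlo thi)
open B8Eq119TwistedAxialRec (UnderZ InAxZ Restr129Z)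
open B8Eq106LocalRec (eq106_of_inAxZ_restr129Z under_iff_tower)
open B8Eq178AveragesRec (QnlZ)
open B8Eq1123ConcreteRec (CnlZ)

-- `Site` alone would resolve to the torus sites of `Setup.lean`; re-export the `ℤ^d` sites of `B7Prop1Explicit`.
export B7Prop1Explicit (Site)

variable {d : ℕ}

/-! ## §4 (1.114)–(1.116) on `𝔅_k`, record structure: the solution linearises `Q′(u₁, ·)` -/

section Eq1114

variable {𝔸 : Type*} [NormedRing 𝔸] [NormedAlgebra ℂ 𝔸] [CompleteSpace 𝔸]

/-- **(1.114) FROM (1.115)–(1.117) ON `𝔅_k`, record structure** (twin of `eq1114_of_fixedPoint_kLevel`): if `X` solves (1.117) at every `(j, y ∈ Λ_j)`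
(`C′_j(u₁, λ − H′X)(y) = X(j, y)` for the centred (0.4) remainder `CnlZ`) and `Q′H′ = I` on `𝔅_k` for the record stencil `QprimeIter (zdBlockingZ d L) (bgTZ L U₀)`, then
`Q′_j(u₁, λ − H′X)(y) = (Q′_jλ)(y)` for `y ∈ Λ_j` — (213) is the definition of `CnlZ`; pure algebra.
[cite: Balaban1985RegularSpaces, (1.113)–(1.116) pp.95–96, (1.91) p.91; Balaban1985Averaging, (213) p.50] -/
theorem eq1114_of_fixedPoint_kLevel {L : ℕ} {U₀ : Site d → Fin d → 𝔸ˣ} {u₁ : Site d → 𝔸ˣ} {k : ℕ} (Λ : ℕ → Set (Site d))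
    (H' : XSpace d k 𝔸 →ₗ[ℂ] (Site d → 𝔸)) {lam : Site d → 𝔸} {X : XSpace d k 𝔸}
    (hQH : ∀ (Y : XSpace d k 𝔸) (j : ℕ) (hj : j ≤ k) (y : Site d), y ∈ Λ j →
      QprimeIter (zdBlockingZ d L) (bgTZ L U₀) j (H' Y) y = Y (⟨j, Nat.lt_succ_of_le hj⟩, y))
    (hfix : ∀ (j : ℕ) (hj : j ≤ k) (y : Site d), y ∈ Λ j →
      CnlZ L U₀ u₁ j (lam - H' X) y = X (⟨j, Nat.lt_succ_of_le hj⟩, y)) :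
    ∀ (j : ℕ), j ≤ k → ∀ y ∈ Λ j,
      QnlZ L U₀ (fun x => expUnit ((lam - H' X) x)) u₁ j y = QprimeIter (zdBlockingZ d L) (bgTZ L U₀) j lam y := by
  intro j hj y hy
  -- (213): `Q′(u₁, μ) = Q′μ + C′(μ)` is the definition of `CnlZ`
  have h213 : QnlZ L U₀ (fun x => expUnit ((lam - H' X) x)) u₁ j y =
      QprimeIter (zdBlockingZ d L) (bgTZ L U₀) j (lam - H' X) y + CnlZ L U₀ u₁ j (lam - H' X) y := by
    rw [CnlZ]; abel
  -- linearity of `Q′_j`: `Q′(λ − H′X) = Q′λ − Q′H′X`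
  have hlin : QprimeIter (zdBlockingZ d L) (bgTZ L U₀) j (lam - H' X) y =
      QprimeIter (zdBlockingZ d L) (bgTZ L U₀) j lam y - QprimeIter (zdBlockingZ d L) (bgTZ L U₀) j (H' X) y := by
    have h1 : lam - H' X = lam + (-1 : ℂ) • H' X := by rw [neg_one_smul, sub_eq_add_neg]
    rw [h1, QprimeIter_line, neg_one_smul, sub_eq_add_neg]
  rw [h213, hlin, hQH X j hj y hy, hfix j hj y hy]
  abel

end Eq1114

/-! ## §5 For THE inductive `u₁`: `u₁ = glevZ_j` on the centred towers `Bʲ(Λ_j)` from (1.19)∕(1.29) (dag-n05-d's `eq106_of_inAxZ_restr129Z`) -/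

section Axial

variable {𝔸 : Type*} [NormedRing 𝔸] [NormedAlgebra ℂ 𝔸] [CompleteSpace 𝔸]

/-- «`u₁` … is determined uniquely in terms of `U₁` and is given by (106)» (p. 88), record structure (twin of `glev_on_towers_of_axial`): if `U₁^{u₁}U₀ ∈ Ax_k(𝔅_k, U₀)`
((1.19), `InAxZ`) and `u₁` satisfies (1.29) (`Restr129Z`), then `u₁ = glevZ_j` on every CENTRED tower `Bʲ(y)` (`tlo L y j ≤ x ≤ thi L y j`), `y ∈ Λ_j`, `j ≤ k` — dag-n05-d's
`B8Eq106LocalRec.eq106_of_inAxZ_restr129Z` rewritten from `UnderZ` to the tower box; odd `L = 2s+1`.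
[cite: Balaban1985RegularSpaces, p.88 (sentence after (1.69)), (1.19) p.79, (1.29) p.81; Balaban1985Averaging, (106) p.33; Balaban1987RG1, (0.3) p.252] -/
theorem glevZ_on_towers_of_axial {L s : ℕ} (hLs : L = 2 * s + 1) (hL1 : 1 ≤ L) {k : ℕ} (Λ : ℕ → Set (Site d)) {U₀ : Site d → Fin d → 𝔸ˣ}
    {B : Site d → Fin d → 𝔸} {u₁ : Site d → 𝔸ˣ}
    (hAx : InAxZ L k Λ U₀ (mgauge U₀ u₁ (expCfg B) * U₀)) (h129 : Restr129Z L k Λ U₀ u₁) :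
    ∀ j, j ≤ k → ∀ y ∈ Λ j, ∀ x : Site d, tlo L y j ≤ x → x ≤ thi L y j → u₁ x = glevZ L hL1 U₀ (expCfg B) j 0 x :=
  fun _ hj _ hy x hx hx' =>
    eq106_of_inAxZ_restr129Z hLs hL1 k Λ U₀ (expCfg B) u₁ hAx h129 hj hy x ((under_iff_tower ⟨s, by omega⟩ _ _ x).2 ⟨hx, hx'⟩)

end Axial

end Literature.MathematicalPhysics.QuantumFieldTheory.Balaban1983to89.B8Eq1117KLevelRec

end
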